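import Literature.Geometry.Riemannian.MeasureSupportSpace
import Literature.Geometry.Riemannian.WassersteinW1Complete
import Literature.Geometry.Riemannian.WassersteinW1Duality
import Literature.Geometry.Riemannian.WassersteinW1OptimalCoupling
import Literature.Geometry.Riemannian.GromovW1Triangle
import Literature.Geometry.Riemannian.MetricFlowWassersteinMonotoneGeneral
import HarnessLib

/-!
# Subconvergence within a correspondence over finitely many times — the `W₁`-toolbox
# (Bamler 2023, §7.3, Lemma 7.? (arXiv v1 Lemma 161), proof)

R. Bamler, *Compactness theory of the space of super Ricci flows*, Invent. Math. 233 (2023), §7.3,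
Lemma (arXiv v1 Lemma 161): *"Fix some `H, V ≥ 0`, `r > 0`, a function `b : (0,1] → (0,1]` and a
finite subset `I₀ ⊂ I ⊂ ℝ` of an interval. Consider a sequence of metric flow pairs
`(𝒳ⁱ, (μⁱ_t)_{t ∈ I})` representing classes in `𝔽_I^I(H, V, b, r)`, `i = 1, 2, …`. Then, after
passing to a subsequence, we can find a correspondence `ℭ₀` between the metric flows `𝒳ⁱ` over
`I₀` that is also fully defined over `I₀` such that the metric flow pairs `(𝒳ⁱ, (μⁱ_t)_{t ∈ I})`
form Cauchy sequence within `ℭ₀` uniformly over `I₀`"*. Its proof (p. 60–61 of arXiv v1) runs on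
three pieces of pure `W₁`-bookkeeping, provided here abstractly:

* `le_of_forall_le_add_add_of_tendsto`, `le_of_forall_le_add_of_tendsto`,
  `tendsto_zero_of_forall_eventually_le_ofReal`, `exists_forall_edist_lt_of_tendsto` — limits in
  `[0, ∞]` ("`ε/3`-arguments");
* `IsCoupling.exists_glue_lintegral_le` — *"As in the proof of Proposition 5.14 … we can construct
  a coupling `q^{i,j}_{t_k}` between `μⁱ_{t_k}, μʲ_{t_k}`"*: two couplings `qⁱ` of `μⁱ, m` and `qʲ`
  of `μʲ, m` with a common second marginal glue (`IsCoupling.exists_glue`) to a coupling `Q` of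
  `μⁱ, μʲ` with `∫ G dQ ≤ ∫ Fⁱ dqⁱ + ∫ Fʲ dqʲ` whenever `G(xⁱ, xʲ) ≤ Fⁱ(xⁱ, y) + Fʲ(xʲ, y)`;
* `exists_isCompact_lintegral_infEDist_lt` — *"Since `K` can be chosen such that …
  `μ_{t_k}(X^∞_{t_k} ∖ K)` is arbitrarily small"*: a compact `C` with `∫ d(·, C) dμ < η` for a finite
  measure of finite first moment on a Polish space;
* `wassersteinW1_limit_le_edist_of_tendsto`, `exists_lipschitz_kernel_extension` — *"Since the
  spaces `X^∞_{t_k}` are separable and the maps `y ↦ (φⁱ_{t_l})_* νⁱ_{y;t_l}` are `1`-Lipschitz, we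
  may pass to a subsequence and assume that (7.22) holds for all … `x^∞ ∈ X^∞_{t_k}`"*: the
  `W₁`-limits of `1`-Lipschitz probability-measure-valued maps along a countable dense set of base
  points form a `1`-Lipschitz family, which extends (by completeness of `(𝒫(Z), d_{W₁})`,
  `exists_tendsto_wassersteinW1_nhds_zero_of_cauchySeq`) to a `1`-Lipschitz family on the whole space;
* `exists_isCoupling_supportMeasure_lintegral_le`, `lintegral_edist_supportMeasure_ne_top` —
  *"Choose couplings `qⁱ_{t_k}` between `μⁱ_{t_k}, μ^∞_{t_k}` with
  `∫ d^Z_{t_k}(φⁱ_{t_k}(xⁱ), φ^∞_{t_k}(x^∞)) dqⁱ_{t_k} → 0`"* (7.21): an optimal coupling in the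
  comparison space pulled back to `𝒳ⁱ_{t_k} × supp μ^∞_{t_k}` (`IsCoupling.comap_prodMap`).

Everything is proved; no definitions, no named facts.

## References

* R. H. Bamler, *Compactness theory of the space of super Ricci flows*, Invent. Math. 233 (2023),
  1121–1277 (arXiv:2008.09298), §7.3, Lemma 7.? (arXiv v1 Lemma 161) and its proof, (7.20)–(7.22),
  Claims 7.? (arXiv v1 Claims 162, 163). [Bamler2023]
* C. Villani, *Topics in Optimal Transportation*, GSM 58 (AMS 2003), Lemma 7.6, §7.1. [Villani2003]
-/

noncomputable section

open Set MeasureTheory Filter TopologicalSpace Function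
open scoped Topology ENNReal NNReal

namespace Literature.Geometry.Riemannian

universe u

/-! ### Limits in `[0, ∞]` -/

/-- If `a ≤ B n + c n + c' n` for all large `n` with `B n → b`, `c n → 0`, `c' n → 0` in `[0, ∞]`,
then `a ≤ b` (addition is continuous on `[0, ∞]`). [folklore] -/
theorem le_of_forall_le_add_add_of_tendsto {a b : ℝ≥0∞} {B c c' : ℕ → ℝ≥0∞}
    (hB : Tendsto B atTop (𝓝 b)) (hc : Tendsto c atTop (𝓝 0)) (hc' : Tendsto c' atTop (𝓝 0))
    (h : ∀ᶠ n in atTop, a ≤ B n + c n + c' n) : a ≤ b := by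
  have hlim : Tendsto (fun n ↦ B n + c n + c' n) atTop (𝓝 (b + 0 + 0)) := (hB.add hc).add hc'
  rw [add_zero, add_zero] at hlim
  exact ge_of_tendsto hlim h

/-- If `a ≤ B n + c n` for all large `n` with `B n → b`, `c n → 0` in `[0, ∞]`, then `a ≤ b`.
[folklore] -/
theorem le_of_forall_le_add_of_tendsto {a b : ℝ≥0∞} {B c : ℕ → ℝ≥0∞}
    (hB : Tendsto B atTop (𝓝 b)) (hc : Tendsto c atTop (𝓝 0))
    (h : ∀ᶠ n in atTop, a ≤ B n + c n) : a ≤ b :=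
  le_of_forall_le_add_add_of_tendsto (c' := fun _ ↦ 0) hB hc tendsto_const_nhds
    (h.mono fun n hn ↦ by rwa [add_zero])

/-- A sequence in `[0, ∞]` which is eventually `≤ ε` for every real `ε > 0` tends to `0`.
[folklore] -/
theorem tendsto_zero_of_forall_eventually_le_ofReal {f : ℕ → ℝ≥0∞}
    (h : ∀ ε : ℝ, 0 < ε → ∀ᶠ n in atTop, f n ≤ ENNReal.ofReal ε) :
    Tendsto f atTop (𝓝 0) := by
  rw [ENNReal.tendsto_atTop_zero]
  intro η hη
  rcases eq_or_ne η ∞ with rfl | hηtop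
  · exact ⟨0, fun n _ ↦ le_top⟩
  · obtain ⟨N, hN⟩ := eventually_atTop.1 (h η.toReal (ENNReal.toReal_pos hη.ne' hηtop))
    exact ⟨N, fun n hn ↦ (hN n hn).trans_eq (ENNReal.ofReal_toReal hηtop)⟩

/-- A convergent sequence in a metric space has `edist (u k) (u l) < η` for large `k, l`
(`η ∈ (0, ∞]`). [folklore] -/
theorem exists_forall_edist_lt_of_tendsto {S : Type*} [PseudoMetricSpace S] {u : ℕ → S} {y : S}
    (hu : Tendsto u atTop (𝓝 y)) {η : ℝ≥0∞} (hη : 0 < η) :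
    ∃ N, ∀ k ≥ N, ∀ l ≥ N, edist (u k) (u l) < η := by
  rcases eq_or_ne η ∞ with rfl | hηtop
  · exact ⟨0, fun k _ l _ ↦ edist_lt_top _ _⟩
  have hε : 0 < η.toReal / 2 := half_pos (ENNReal.toReal_pos hη.ne' hηtop)
  obtain ⟨N, hN⟩ := Metric.tendsto_atTop.1 hu _ hε
  refine ⟨N, fun k hk l hl ↦ ?_⟩
  calc edist (u k) (u l) ≤ edist (u k) y + edist y (u l) := edist_triangle _ _ _
    _ = ENNReal.ofReal (dist (u k) y) + ENNReal.ofReal (dist (u l) y) := by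
        rw [edist_dist, edist_dist, dist_comm y]
    _ < ENNReal.ofReal (η.toReal / 2) + ENNReal.ofReal (η.toReal / 2) :=
        ENNReal.add_lt_add ((ENNReal.ofReal_lt_ofReal_iff hε).2 (hN k hk))
          ((ENNReal.ofReal_lt_ofReal_iff hε).2 (hN l hl))
    _ = η := by rw [← ENNReal.ofReal_add hε.le hε.le, add_halves, ENNReal.ofReal_toReal hηtop]

/-! ### Gluing two couplings with a common second marginal -/

/-- **Gluing two couplings along a common marginal, with the integrated triangle inequality**
(Bamler 2023, §7.3, proof of Lemma 7.? (arXiv v1 Lemma 161), last step: *"As in the proof of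
Proposition 5.14, for any `k = 1, …, N`, `1 ≤ i ≤ j` we can construct a coupling `q^{i,j}_{t_k}`
between `μⁱ_{t_k}, μʲ_{t_k}` such that …"*): couplings `q₁` of `μ₁, m` on `X₁ × S` and `q₂` of
`μ₂, m` on `X₂ × S` (`X₁, X₂` standard Borel) glue (`IsCoupling.exists_glue`, Villani's Lemma 7.6)
to a measure `γ` on `S × (X₁ × X₂)` whose `(X₁ × X₂)`-marginal `Q` couples `μ₁, μ₂` and satisfies
`∫ G dQ ≤ ∫ F₁ dq₁ + ∫ F₂ dq₂` for all measurable `F₁, F₂ ≥ 0` and all `G` with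
`G(x₁, x₂) ≤ F₁(x₁, y) + F₂(x₂, y)`.
[cite: Bamler2023, §7.3, Lemma 7.? (arXiv v1 Lemma 161), proof] [cite: Villani2003, Lemma 7.6] -/
theorem IsCoupling.exists_glue_lintegral_le {X₁ X₂ S : Type*} [MeasurableSpace X₁]
    [MeasurableSpace X₂] [MeasurableSpace S] [StandardBorelSpace X₁] [StandardBorelSpace X₂]
    {μ₁ : Measure X₁} {μ₂ : Measure X₂} {m : Measure S} {q₁ : Measure (X₁ × S)}
    {q₂ : Measure (X₂ × S)} (h₁ : IsCoupling μ₁ m q₁) (h₂ : IsCoupling μ₂ m q₂) :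
    ∃ Q : Measure (X₁ × X₂), IsCoupling μ₁ μ₂ Q ∧
      ∀ (F₁ : X₁ × S → ℝ≥0∞) (F₂ : X₂ × S → ℝ≥0∞), Measurable F₁ → Measurable F₂ →
        ∀ G : X₁ × X₂ → ℝ≥0∞, (∀ x₁ x₂ y, G (x₁, x₂) ≤ F₁ (x₁, y) + F₂ (x₂, y)) →
          ∫⁻ p, G p ∂Q ≤ ∫⁻ p, F₁ p ∂q₁ + ∫⁻ p, F₂ p ∂q₂ := by
  obtain ⟨hq₂P, hq₂1, hq₂2⟩ := h₂
  haveI := hq₂P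
  -- the swapped coupling of `m, μ₂`
  have h₂' : IsCoupling m μ₂ (q₂.map Prod.swap) :=
    ⟨Measure.isProbabilityMeasure_map measurable_swap.aemeasurable,
      by rw [Measure.fst_map_swap]; exact hq₂2, by rw [Measure.snd_map_swap]; exact hq₂1⟩
  obtain ⟨γ, hγP, hγ₁, hγ₂⟩ := h₁.exists_glue h₂'
  haveI := hγP
  have hm₁ : Measurable fun p : S × (X₁ × X₂) ↦ (p.2.1, p.1) :=
    measurable_snd.fst.prodMk measurable_fst
  have hm₂ : Measurable fun p : S × (X₁ × X₂) ↦ (p.1, p.2.2) :=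
    measurable_fst.prodMk measurable_snd.snd
  refine ⟨γ.map Prod.snd, ⟨Measure.isProbabilityMeasure_map measurable_snd.aemeasurable, ?_, ?_⟩,
    fun F₁ F₂ hF₁ hF₂ G hG ↦ ?_⟩
  · rw [Measure.fst, Measure.map_map measurable_fst measurable_snd, ← h₁.2.1, ← hγ₁, Measure.fst,
      Measure.map_map measurable_fst hm₁]
    rfl
  · rw [Measure.snd, Measure.map_map measurable_snd measurable_snd, ← h₂'.2.2, ← hγ₂, Measure.snd,
      Measure.map_map measurable_snd hm₂]
    rfl
  · have hF₂s : Measurable fun p : S × X₂ ↦ F₂ p.swap := hF₂.comp measurable_swap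
    calc ∫⁻ p, G p ∂(γ.map Prod.snd) ≤ ∫⁻ p, G p.2 ∂γ := lintegral_map_le _ _
      _ ≤ ∫⁻ p, F₁ (p.2.1, p.1) + F₂ (p.2.2, p.1) ∂γ := lintegral_mono fun p ↦ hG p.2.1 p.2.2 p.1
      _ = ∫⁻ p, F₁ (p.2.1, p.1) ∂γ + ∫⁻ p, F₂ (p.2.2, p.1) ∂γ := lintegral_add_left (hF₁.comp hm₁) _
      _ = ∫⁻ p, F₁ p ∂(γ.map fun p ↦ (p.2.1, p.1)) +
            ∫⁻ p, F₂ p.swap ∂(γ.map fun p ↦ (p.1, p.2.2)) := by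
          rw [lintegral_map hF₁ hm₁, lintegral_map hF₂s hm₂]
          rfl
      _ = ∫⁻ p, F₁ p ∂q₁ + ∫⁻ p, F₂ p ∂q₂ := by
          rw [hγ₁, hγ₂, lintegral_map hF₂s measurable_swap]
          rfl

/-! ### A compact set close to a measure of finite first moment -/

/-- **A compact set `C` with `∫ d(y, C) dμ(y) < η`** for a finite measure `μ` with a finite first
moment on a Polish space (Bamler 2023, §7.3, proof of Lemma 7.?, the step *"Since `K` can be chosen
such that … `μ_{t_k}(X^∞_{t_k} ∖ K)` is arbitrarily small"*, here with the elementary bound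
`d(y, C) ≤ 𝟙_{Kᶜ}(y) d(y, y₀)` for `C = K ∪ {y₀}` in place of the printed Cauchy–Schwarz estimate):
inner regularity of the finite measure `d(y₀, ·) μ` (`exists_isCompact_isClosed_setLIntegral_compl_lt`).
[cite: Bamler2023, §7.3, Lemma 7.? (arXiv v1 Lemma 161), proof] -/
theorem exists_isCompact_lintegral_infEDist_lt {S : Type*} [MetricSpace S] [MeasurableSpace S]
    [BorelSpace S] [SecondCountableTopology S] [CompleteSpace S] (μ : Measure S) [IsFiniteMeasure μ]
    (y₀ : S) (h : ∫⁻ y, edist y₀ y ∂μ ≠ ∞) {η : ℝ≥0∞} (hη : 0 < η) :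
    ∃ C : Set S, IsCompact C ∧ ∫⁻ y, Metric.infEDist y C ∂μ < η := by
  obtain ⟨K, hK, hKc, hlt⟩ := exists_isCompact_isClosed_setLIntegral_compl_lt μ h hη
  refine ⟨insert y₀ K, hK.insert y₀, lt_of_le_of_lt ?_ hlt⟩
  rw [← lintegral_indicator hKc.measurableSet.compl]
  refine lintegral_mono fun y ↦ ?_
  by_cases hy : y ∈ K
  · rw [Metric.infEDist_zero_of_mem (mem_insert_of_mem _ hy)]
    exact bot_le
  · rw [indicator_of_mem (show y ∈ Kᶜ from hy), edist_comm]
    exact Metric.infEDist_le_edist_of_mem (mem_insert _ _)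

/-! ### `W₁`-limits of `1`-Lipschitz families of probability measures -/

section LipschitzLimits

variable {Zl : Type*} [MetricSpace Zl] [MeasurableSpace Zl] [BorelSpace Zl]
  [SecondCountableTopology Zl] [CompleteSpace Zl]

/-- **Limits of a `1`-Lipschitz family along converging base points are `1`-Lipschitz in the
limit points** (Bamler 2023, §7.3, proof of Lemma 7.?, after Claim 7.? (arXiv v1 Claim 162):
*"the maps `(𝒳ⁱ_{t_k}, dⁱ_{t_k}) → (𝒫(Z_{t_l}), d^{Z_{t_l}}_{W₁})`, `y ↦ (φⁱ_{t_l})_* νⁱ_{y;t_l}` are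
`1`-Lipschitz"*): if `aₙ : Xₙ → 𝒫(Z_l)` are `1`-Lipschitz for `d_{W₁}`, `eₙ : Xₙ → Z_k` are isometric
embeddings, `eₙ(x^D_{i,n}) → D_i` and `d_{W₁}(aₙ(x^D_{i,n}), K₀ i) → 0`, then
`d_{W₁}(K₀ i, K₀ j) ≤ d(D_i, D_j)` (two triangle inequalities and a limit).
[cite: Bamler2023, §7.3, Lemma 7.? (arXiv v1 Lemma 161), proof] -/
theorem wassersteinW1_limit_le_edist_of_tendsto {ι : Type*} {X : ℕ → Type*}
    [∀ n, PseudoEMetricSpace (X n)] {Zk : Type*} [PseudoEMetricSpace Zk]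
    (a : ∀ n, X n → Measure Zl) [∀ n x, IsProbabilityMeasure (a n x)]
    (ha : ∀ n x x', wassersteinW1 (a n x) (a n x') ≤ edist x x')
    (e : ∀ n, X n → Zk) (he : ∀ n, Isometry (e n)) {D : ι → Zk} {xD : ι → ∀ n, X n}
    (hxD : ∀ i, Tendsto (fun n ↦ e n (xD i n)) atTop (𝓝 (D i)))
    {K₀ : ι → Measure Zl} [∀ i, IsProbabilityMeasure (K₀ i)]
    (hK₀ : ∀ i, Tendsto (fun n ↦ wassersteinW1 (a n (xD i n)) (K₀ i)) atTop (𝓝 0)) (i j : ι) :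
    wassersteinW1 (K₀ i) (K₀ j) ≤ edist (D i) (D j) := by
  refine le_of_forall_le_add_add_of_tendsto ((hxD i).edist (hxD j)) (hK₀ i) (hK₀ j)
    (Eventually.of_forall fun n ↦ ?_)
  calc wassersteinW1 (K₀ i) (K₀ j)
      ≤ wassersteinW1 (K₀ i) (a n (xD i n)) + wassersteinW1 (a n (xD i n)) (K₀ j) :=
        wassersteinW1_triangle _ _ _
    _ ≤ wassersteinW1 (K₀ i) (a n (xD i n)) +
          (wassersteinW1 (a n (xD i n)) (a n (xD j n)) + wassersteinW1 (a n (xD j n)) (K₀ j)) :=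
        add_le_add le_rfl (wassersteinW1_triangle _ _ _)
    _ ≤ wassersteinW1 (a n (xD i n)) (K₀ i) +
          (edist (e n (xD i n)) (e n (xD j n)) + wassersteinW1 (a n (xD j n)) (K₀ j)) := by
        rw [wassersteinW1_comm (K₀ i), (he n).edist_eq]
        exact add_le_add le_rfl (add_le_add (ha n _ _) le_rfl)
    _ = edist (e n (xD i n)) (e n (xD j n)) + wassersteinW1 (a n (xD i n)) (K₀ i) +
          wassersteinW1 (a n (xD j n)) (K₀ j) := by
        rw [add_left_comm, ← add_assoc]

/-- **Extension of a `1`-Lipschitz family of probability measures from a dense sequence**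
(Bamler 2023, §7.3, proof of Lemma 7.?: the limit kernels `ν^∞_{x^∞;t_l}`, first obtained for
`x^∞` in a countable dense subset of `X^∞_{t_k}`, are defined at every point by density and the
completeness of `(𝒫(Z_{t_l}), d_{W₁})`): if `D : ℕ → S` has dense range and `K₀ k ∈ 𝒫(Z_l)`
satisfy `d_{W₁}(K₀ k, K₀ l) ≤ d(D k, D l)`, then there is `K : S → 𝒫(Z_l)` with
`d_{W₁}(K y, K y') ≤ d(y, y')` and `d_{W₁}(K₀ k, K (D k)) = 0`: `K y := lim K₀(D_{σ(y,n)})` along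
indices with `D_{σ(y,n)} → y` (a `W₁`-Cauchy sequence, `exists_tendsto_wassersteinW1_nhds_zero_of_cauchySeq`).
[cite: Bamler2023, §7.3, Lemma 7.? (arXiv v1 Lemma 161), proof] -/
theorem exists_lipschitz_kernel_extension {S : Type*} [MetricSpace S] {D : ℕ → S}
    (hD : DenseRange D) (K₀ : ℕ → Measure Zl) [∀ k, IsProbabilityMeasure (K₀ k)]
    (hK₀ : ∀ k l, wassersteinW1 (K₀ k) (K₀ l) ≤ edist (D k) (D l)) :
    ∃ K : S → Measure Zl, (∀ y, IsProbabilityMeasure (K y)) ∧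
      (∀ y y', wassersteinW1 (K y) (K y') ≤ edist y y') ∧
        ∀ k, wassersteinW1 (K₀ k) (K (D k)) = 0 := by
  -- indices `σ y n` with `dist y (D (σ y n)) < 1 / (n + 1)`
  have hex : ∀ (y : S) (n : ℕ), ∃ j, dist y (D j) < 1 / ((n : ℝ) + 1) := fun y n ↦
    hD.exists_dist_lt y Nat.one_div_pos_of_nat
  choose σ hσ using hex
  have hσt : ∀ y, Tendsto (fun n ↦ D (σ y n)) atTop (𝓝 y) := fun y ↦ by
    rw [tendsto_iff_dist_tendsto_zero]
    refine squeeze_zero (fun n ↦ dist_nonneg) (fun n ↦ ?_) tendsto_one_div_add_atTop_nhds_zero_nat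
    rw [dist_comm]
    exact (hσ y n).le
  -- the sequences `K₀ (σ y n)` are `W₁`-Cauchy, hence convergent
  have hCauchy : ∀ y, ∀ η : ℝ≥0∞, 0 < η → ∃ N, ∀ k ≥ N, ∀ l ≥ N,
      wassersteinW1 (K₀ (σ y k)) (K₀ (σ y l)) < η := by
    intro y η hη
    obtain ⟨N, hN⟩ := exists_forall_edist_lt_of_tendsto (hσt y) hη
    exact ⟨N, fun k hk l hl ↦ (hK₀ _ _).trans_lt (hN k hk l hl)⟩
  choose K hKP hKt using fun y ↦
    exists_tendsto_wassersteinW1_nhds_zero_of_cauchySeq (μs := fun n ↦ K₀ (σ y n)) (hCauchy y)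
  refine ⟨K, hKP, fun y y' ↦ ?_, fun k ↦ ?_⟩
  · -- `1`-Lipschitz
    haveI := hKP y
    haveI := hKP y'
    refine le_of_forall_le_add_add_of_tendsto ((hσt y).edist (hσt y')) (hKt y) (hKt y')
      (Eventually.of_forall fun n ↦ ?_)
    calc wassersteinW1 (K y) (K y')
        ≤ wassersteinW1 (K y) (K₀ (σ y n)) + wassersteinW1 (K₀ (σ y n)) (K y') :=
          wassersteinW1_triangle _ _ _
      _ ≤ wassersteinW1 (K y) (K₀ (σ y n)) +
            (wassersteinW1 (K₀ (σ y n)) (K₀ (σ y' n)) + wassersteinW1 (K₀ (σ y' n)) (K y')) :=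
          add_le_add le_rfl (wassersteinW1_triangle _ _ _)
      _ ≤ wassersteinW1 (K₀ (σ y n)) (K y) +
            (edist (D (σ y n)) (D (σ y' n)) + wassersteinW1 (K₀ (σ y' n)) (K y')) := by
          rw [wassersteinW1_comm (K y)]
          exact add_le_add le_rfl (add_le_add (hK₀ _ _) le_rfl)
      _ = edist (D (σ y n)) (D (σ y' n)) + wassersteinW1 (K₀ (σ y n)) (K y) +
            wassersteinW1 (K₀ (σ y' n)) (K y') := by
          rw [add_left_comm, ← add_assoc]
  · -- `d_{W₁}(K₀ k, K (D k)) = 0`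
    haveI := hKP (D k)
    refine le_antisymm ?_ bot_le
    have hB : Tendsto (fun n ↦ edist (D k) (D (σ (D k) n))) atTop (𝓝 0) := by
      have h := (tendsto_const_nhds (x := D k)).edist (hσt (D k))
      rwa [edist_self] at h
    refine le_of_forall_le_add_of_tendsto hB (hKt (D k)) (Eventually.of_forall fun n ↦ ?_)
    calc wassersteinW1 (K₀ k) (K (D k))
        ≤ wassersteinW1 (K₀ k) (K₀ (σ (D k) n)) + wassersteinW1 (K₀ (σ (D k) n)) (K (D k)) :=
          wassersteinW1_triangle _ _ _
      _ ≤ edist (D k) (D (σ (D k) n)) + wassersteinW1 (K₀ (σ (D k) n)) (K (D k)) :=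
          add_le_add (hK₀ _ _) le_rfl

end LipschitzLimits

/-! ### Couplings with the support space of the limit measure -/

/-- **The couplings (7.21)**: for an isometric embedding `e : X → Z` of a complete space into a
Polish space, a probability measure `μ` on `X` and a probability measure `m` on `Z`, there is a
coupling `q` of `μ` and `m|_{supp m}` on `X × supp m` with
`∫ d_Z(e(x), y) dq(x, y) ≤ d^Z_{W₁}(e_* μ, m)` — an optimal coupling of `e_* μ, m`
(`exists_isCoupling_lintegral_edist_eq_wassersteinW1`) pulled back along `e × (supp m ↪ Z)`
(`IsCoupling.comap_prodMap`, `map_val_supportMeasure`).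
[cite: Bamler2023, §7.3, Lemma 7.? (arXiv v1 Lemma 161), proof, (7.21)] -/
theorem exists_isCoupling_supportMeasure_lintegral_le {X Z : Type*} [MetricSpace X]
    [MeasurableSpace X] [BorelSpace X] [CompleteSpace X] [MetricSpace Z] [MeasurableSpace Z]
    [BorelSpace Z] [SecondCountableTopology Z] [CompleteSpace Z] {e : X → Z} (he : Isometry e)
    (μ : Measure X) [IsProbabilityMeasure μ] (m : Measure Z) [IsProbabilityMeasure m] :
    ∃ q : Measure (X × m.support), IsCoupling μ (supportMeasure m) q ∧
      ∫⁻ p, edist (e p.1) (p.2 : Z) ∂q ≤ wassersteinW1 (μ.map e) m := by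
  haveI : IsProbabilityMeasure (μ.map e) :=
    Measure.isProbabilityMeasure_map he.continuous.measurable.aemeasurable
  obtain ⟨π, hπ, hcost⟩ := exists_isCoupling_lintegral_edist_eq_wassersteinW1 (μ.map e) m
  have h₁ : MeasurableEmbedding e := he.isClosedEmbedding.measurableEmbedding
  have h₂ : MeasurableEmbedding (Subtype.val : m.support → Z) :=
    MeasurableEmbedding.subtype_coe (measurableSet_support m)
  have hπ' : IsCoupling (μ.map e) ((supportMeasure m).map Subtype.val) π := by
    rwa [map_val_supportMeasure]
  obtain ⟨hc, hmap⟩ := hπ'.comap_prodMap h₁ h₂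
  refine ⟨π.comap (Prod.map e Subtype.val), hc, le_of_eq ?_⟩
  calc ∫⁻ p : X × m.support, edist (e p.1) (p.2 : Z) ∂(π.comap (Prod.map e Subtype.val))
      = ∫⁻ z, edist z.1 z.2 ∂((π.comap (Prod.map e Subtype.val)).map (Prod.map e Subtype.val)) :=
        ((h₁.prodMap h₂).lintegral_map (fun z : Z × Z ↦ edist z.1 z.2)).symm
    _ = wassersteinW1 (μ.map e) m := by rw [hmap, hcost]

/-- **The support space of a measure of finite variance has finite first moments**:
`∫ d(y₀, y) dm|_{supp m}(y) < ∞` (`lintegral_supportMeasure`,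
`lintegral_edist_ne_top_of_variance_ne_top`). [folklore] -/
theorem lintegral_edist_supportMeasure_ne_top {Z : Type u} [MetricSpace Z] [MeasurableSpace Z]
    [BorelSpace Z] [SecondCountableTopology Z] (m : Measure Z) [IsProbabilityMeasure m]
    (hV : variance m m ≠ ∞) (y₀ : m.support) :
    ∫⁻ y, edist y₀ y ∂(supportMeasure m) ≠ ∞ := by
  have h : ∫⁻ y, edist y₀ y ∂(supportMeasure m) = ∫⁻ z, edist (y₀ : Z) z ∂m :=
    lintegral_supportMeasure m (fun z ↦ edist (y₀ : Z) z)
  rw [h]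
  exact lintegral_edist_ne_top_of_variance_ne_top m hV _

end Literature.Geometry.Riemannian

end
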